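/-
Copyright (c) 2026. All rights reserved.
Released under Apache 2.0 license as described in the file LICENSE.
Authors: abc-iut cell, seat abc-iut-L4-t14 (gen 4; proof-only assembly: [AbsTopIII] Prop 4.2 (i)
«objects of EA mapping to X id-rigid» at the uniformised model IN PRINT'S RC-CATEGORY (holomorphic AND
anti-holomorphic finite étale morphisms), X = ℍ/Γ̄ with Γ̄ free of rank ≥ 2 — the Lemma 4.3 input for the
full-isometry orbicurve [ℍ/N_{PGL₂(ℝ)}(Γ̄)] discharged by abc-iut-L4-d1's theorem over `PGL(2, ℝ)`).
-/
import Literature.AnabelianGeometry.AbsoluteAnabelian.ArchimedeanHolFieldFunctorGeometricRCPGL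
import Literature.AnabelianGeometry.AbsoluteAnabelian.ArchimedeanHolFieldFunctorGeometricPSLSlim
import Mathlib.Topology.Homotopy.Lifting
import HarnessLib

/-!
# `PGL₂(ℝ)` acts faithfully on `ℍ`; faithfulness of the uniformised RC model; `π̂₁(ℍ/Γ̄)` slim (part 1 of 2)

S. Mochizuki, *Topics in absolute anabelian geometry III*, proof of Prop 4.2 (i) p. 106 l. 14–19 (kurims
`paper:url-5493eb38cbb7`; bib key `MochizukiAbsTopIII2015`): "the full subcategory of `EA` consisting of
objects that map to `X` may, by Corollary 2.3, (i) …, be identified with the category of finite étale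
R-localizations `Loc_R(X)` …. Thus, the id-rigidity of `EA` follows immediately from the slimness
assertion of Lemma 4.3."  Here the morphisms of `EA` are the PRINT-FAITHFUL ones — RC-holomorphic finite
étale maps (Def 4.1 (iii), Cor 2.3 (i); the tree's category `HolRS.RC`, abc-iut-L4-t14 p425328) — and the
ambient group of `Loc_R(X)` for `X = ℍ/Γ̄` is the full isometry group `Isom(ℍ) = PGL(2, ℝ)` (Mathlib).

PROOF-ONLY (no definition, no named fact).  PART 1 (this file) = the three lemmas below; PART 2
(`ArchimedeanHolFieldFunctorGeometricRCPSLIdRigid.lean`) = (H1⁎) and the id-rigidity, for `Γ̄ ≤ PSL₂(ℝ)`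
free of rank `≥ 2` acting freely and properly discontinuously on `ℍ`:

* `HolRS.pgl_eq_one_of_forall_smul_eq` — `PGL(2, ℝ)` acts faithfully on `ℍ` (an orientation-reversing
  isometry is anti-holomorphic, hence not the identity: `isAntiHolAt_J_smul` vs. the tree's
  `not_isHolAt_and_isAntiHolAt_of_injOn`);
* `HolRS.RC.mul_inv_mem_of_forall_mk_smul_eq` — FAITHFULNESS: `q, q' ∈ PGL(2, ℝ)` inducing the same map
  `ℍ → ℍ/Λ̄` differ by an element of `Λ̄` (uniqueness of lifts through the covering `ℍ → ℍ/Λ̄`);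
* `HolRS.isSlimGroup_profiniteCompletion_fundamentalGroup_pslQuotient` — `π̂₁(ℍ/Γ̄)` is slim
  (`π₁(ℍ/Γ̄) ≅ Γ̄ᵐᵒᵖ` by Mathlib's `IsQuotientCoveringMap.fundamentalGroupEquiv`, `Γ̄` free of rank `≥ 2`);
* ★ `HolRS.RC.app_self_eq_id_of_isFreeGroup` — **(H1⁎) in the RC-category**: every automorphism `α` of
  the identity functor of `{Y ∈ RC | Y ⟶ ⟨ℍ/Γ̄⟩}` has `α_X = 𝟙`: by SIGN-FREE RC FULLNESS
  (`RC.exists_pgl_of_hom`, p451543) the components at the uniformised objects `ℍ/Λ̄` are `[τ] ↦ [q_Λ • τ]`,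
  `q_Λ ∈ PGL(2, ℝ)`; naturality makes `(q_Λ)` a compatible `Γ̄`-central family in `N_{PGL₂(ℝ)}(Γ̄)`
  (hypothesis (Z) of abc-iut-L4-t14's group model, `LocObj.CentralFamiliesTrivial` for `N = PGL(2, ℝ)`,
  p432943), which is trivial by `LocObj.centralFamiliesTrivial_of_completion_normalizer` (p433566) over
  abc-iut-L4-d1's `eq_one_of_forall_commute_etaFn_normalizer` (p448081; inputs: `Γ̄` free —
  transported along `toPGL` — and `C_{PGL₂(ℝ)}(Γ̄) = 1`, p448965 `pgl_centralizer_eq_bot`);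
* ★ `HolRS.RC.isIdRigid_mapsTo_pslQuotient_of_isFreeGroup` — **«objects of the RC-category mapping to
  `ℍ/Γ̄`» is ID-RIGID**, hypotheses ONLY {`hfin`, `hN' : [N_{PGL₂(ℝ)}(Γ̄) : Γ̄] < ∞`, `Γ̄` free of rank
  `≥ 2`}: abc-iut-w6-d003's descent `isIdRigid_mapsTo_of_app_self_eq_id` (p441434) from (H1⁎) and the
  id-rigidity of the RC slice `Over ⟨ℍ/Γ̄⟩` (abc-iut-L4-t12's `RC.isIdRigid_over_of_isSlimGroup`, p444100).

MODEL ≠ reconstruction; the orbi objects and `EA` beyond one `X₀` are not treated; nothing here bears on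
[IUTchIII] Cor. 3.12; typed ≠ proved.
-/

set_option autoImplicit false

noncomputable section

open scoped Manifold ContDiff Topology UpperHalfPlane MatrixGroups
open _root_.MulAction _root_.CategoryTheory
open Literature.AlgebraicGeometry.Frobenioids (IsSlimGroup)
open Literature.IUT.HodgeTheaters (profiniteCompletion)
open Matrix.ProjectiveSpecialLinearGroup (toPGL toPGL_mk toPGL_injective)

namespace Literature.AnabelianGeometry.AbsoluteAnabelian

namespace HolRS

/-! ### `PGL(2, ℝ)` acts faithfully on `ℍ` -/

/-- An element of `GL(2, ℝ)` of positive determinant is a scalar multiple of an element of `SL(2, ℝ)`: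
its class in `PGL(2, ℝ)` lies in the image of `PSL₂(ℝ)`. [cite: FarkasKra1992, IV.5.6] -/
theorem exists_toPGL_eq_mk_of_det_pos (g : GL (Fin 2) ℝ) (hg : 0 < g.det.val) :
    ∃ p : PSL2R, toPGL p = Matrix.ProjGenLinGroup.mk g := by
  set d : ℝ := g.det.val with hd
  have hd' : (g : Matrix (Fin 2) (Fin 2) ℝ).det = d := by
    rw [hd, ← Matrix.GeneralLinearGroup.val_det_apply]
  set s : ℝ := Real.sqrt d with hs
  have hspos : 0 < s := Real.sqrt_pos.mpr hg
  have hss : s * s = d := Real.mul_self_sqrt hg.le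
  -- `γ := s⁻¹ • g ∈ SL(2, ℝ)`
  have hdet : (s⁻¹ • (g : Matrix (Fin 2) (Fin 2) ℝ)).det = 1 := by
    rw [Matrix.det_smul, Fintype.card_fin, hd']
    field_simp
    rw [sq, hss]
  refine ⟨QuotientGroup.mk ⟨s⁻¹ • (g : Matrix (Fin 2) (Fin 2) ℝ), hdet⟩, ?_⟩
  rw [toPGL_mk, Matrix.ProjGenLinGroup.mk_eq_mk_iff]
  refine ⟨Units.mk0 s hspos.ne', ?_⟩
  apply Units.ext
  rw [Matrix.GeneralLinearGroup.coe_mul, Matrix.GeneralLinearGroup.coe_scalar, Matrix.scalar_apply,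
    ← Matrix.smul_one_eq_diagonal, Matrix.mul_smul, Matrix.mul_one,
    Matrix.SpecialLinearGroup.coe_GL_coe_matrix]
  change (s : ℝ) • (s⁻¹ • (g : Matrix (Fin 2) (Fin 2) ℝ)) = g
  rw [smul_smul, mul_inv_cancel₀ hspos.ne', one_smul]

/-- **`PGL(2, ℝ) = Isom(ℍ)` acts FAITHFULLY on `ℍ`**: an element acting trivially is `1`.  For positive
determinant this is the faithfulness of `PSL₂(ℝ)` (abc-iut-L4-t14's `psl_eq_one_of_forall_smul_eq`);
an element of negative determinant `q = p · J` acting trivially would make the anti-holomorphic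
`τ ↦ J • τ` equal to the holomorphic `τ ↦ p⁻¹ • τ`, impossible (`not_isHolAt_and_isAntiHolAt_of_injOn`).
[cite: FarkasKra1992, IV.5.6] -/
theorem pgl_eq_one_of_forall_smul_eq {q : PGL(2, ℝ)} (h : ∀ τ : ℍ, q • τ = τ) : q = 1 := by
  induction q using Matrix.ProjGenLinGroup.induction_on with
  | mk g =>
    rcases lt_or_gt_of_ne (g.det.ne_zero : g.det.val ≠ 0) with hneg | hpos
    · -- negative determinant: `g = (g J) J` with `det (g J) > 0`
      exfalso
      have hgJ : 0 < (g * UpperHalfPlane.J).det.val := by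
        rw [map_mul, Units.val_mul, UpperHalfPlane.det_J]
        simp only [Units.val_neg, Units.val_one, mul_neg, mul_one]
        linarith
      obtain ⟨p, hp⟩ := exists_toPGL_eq_mk_of_det_pos (g * UpperHalfPlane.J) hgJ
      -- `J • τ = p • τ` for all `τ`
      have hJ : ∀ τ : ℍ, UpperHalfPlane.J • τ = p • τ := by
        intro τ
        have h1 := h (UpperHalfPlane.J • τ)
        rw [UpperHalfPlane.pglMk_smul, ← mul_smul] at h1
        -- `h1 : (g J) • τ = J • τ`, and `(g J) • τ = p • τ`
        rw [← h1, ← toPGL_smul, hp, UpperHalfPlane.pglMk_smul]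
      -- the map `τ ↦ J • τ` would be holomorphic AND anti-holomorphic at `I`
      have hhol : IsHolAt (fun τ : ℍ => UpperHalfPlane.J • τ) UpperHalfPlane.I := by
        have : (fun τ : ℍ => UpperHalfPlane.J • τ) = fun τ : ℍ => p • τ := funext hJ
        rw [this]
        exact Filter.Eventually.of_forall fun τ => (contMDiff_psl_smul p).mdifferentiable (by simp) τ
      have hinj : Set.InjOn (fun τ : ℍ => UpperHalfPlane.J • τ) Set.univ :=
        fun a _ b _ hab => by simpa [J_smul_J_smul] using congrArg (fun τ => UpperHalfPlane.J • τ) hab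
      exact not_isHolAt_and_isAntiHolAt_of_injOn continuous_J_smul isOpen_univ (Set.mem_univ _) hinj
        ⟨hhol, isAntiHolAt_J_smul _⟩
    · obtain ⟨p, hp⟩ := exists_toPGL_eq_mk_of_det_pos g hpos
      rw [← hp] at h ⊢
      have : p = 1 := psl_eq_one_of_forall_smul_eq fun τ => by rw [← toPGL_smul]; exact h τ
      rw [this, map_one]

/-! ### Faithfulness: two isometries inducing the same map to `ℍ/Λ̄` differ by `Λ̄` -/

/-- **Faithfulness over `PGL(2, ℝ)`**: if `[q • τ] = [q' • τ]` in `ℍ/Λ̄` for all `τ`, then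
`q' q⁻¹ ∈ Λ̄` (inside `PGL(2, ℝ)`): `q' q⁻¹` and a deck transformation `m ∈ Λ̄` agreeing with it at one
point are two lifts of the identity through the covering `ℍ → ℍ/Λ̄`, hence equal
(`UniformizedLift.lift_unique`), and `PGL(2, ℝ)` acts faithfully.
[cite: MochizukiAbsTopIII2015, Proposition 4.2 (i) proof p.106] -/
theorem RC.mul_inv_mem_of_forall_mk_smul_eq (Λ : Subgroup PSL2R) [ProperlyDiscontinuousSMul Λ ℍ]
    [IsCancelSMul Λ ℍ] {q q' : PGL(2, ℝ)}
    (h : ∀ τ : ℍ, (Quotient.mk (orbitRel Λ ℍ) (q • τ)) = Quotient.mk (orbitRel Λ ℍ) (q' • τ)) :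
    q' * q⁻¹ ∈ Λ.map (toPGL (n := Fin 2) (R := ℝ)) := by
  obtain ⟨g, hg⟩ := Matrix.ProjGenLinGroup.mk_surjective (q' * q⁻¹)
  let π : ℍ → orbitRel.Quotient Λ ℍ := Quotient.mk _
  have hπ : IsCoveringMap π :=
    (isQuotientCoveringMap_quotientMk_of_properlyDiscontinuousSMul (G := Λ) (E := ℍ)).isCoveringMap
  have hrπ : ∀ σ : ℍ, π ((g : GL (Fin 2) ℝ) • σ) = π σ := fun σ => by
    have := h (q⁻¹ • σ)
    rw [smul_inv_smul] at this
    change π σ = π (q' • q⁻¹ • σ) at this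
    rw [this, ← mul_smul, ← hg, UpperHalfPlane.pglMk_smul]
  -- `m ∈ Λ̄` with `m • g • I = I`
  obtain ⟨m, hm⟩ := Quotient.exact (hrπ UpperHalfPlane.I)
  -- both `(m⁻¹ g) • ·` and `id` lift the identity through `π` and agree at `I`
  have hcont : Continuous fun σ : ℍ => ((m⁻¹ : Λ) : PSL2R) • ((g : GL (Fin 2) ℝ) • σ) :=
    (continuous_const_smul _).comp (continuous_const_smul _)
  have hbase : ((m⁻¹ : Λ) : PSL2R) • ((g : GL (Fin 2) ℝ) • UpperHalfPlane.I) = UpperHalfPlane.I := by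
    have hm' : (m : PSL2R) • UpperHalfPlane.I = (g : GL (Fin 2) ℝ) • UpperHalfPlane.I := hm
    rw [← hm', Subgroup.coe_inv, inv_smul_smul]
  have hlift : (fun σ : ℍ => ((m⁻¹ : Λ) : PSL2R) • ((g : GL (Fin 2) ℝ) • σ)) = fun σ => σ := by
    refine UniformizedLift.lift_unique (π₁ := fun σ : ℍ => σ) (h := π) hπ hcont continuous_id
      (fun σ => ?_) (fun _ => rfl) (e₁ := UpperHalfPlane.I) hbase
    rw [← hrπ σ]
    exact Quotient.sound ⟨m⁻¹, rfl⟩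
  have hone : toPGL ((m⁻¹ : Λ) : PSL2R) * Matrix.ProjGenLinGroup.mk g = 1 :=
    pgl_eq_one_of_forall_smul_eq fun σ => by
      rw [mul_smul, UpperHalfPlane.pglMk_smul, toPGL_smul]; exact congr_fun hlift σ
  have : Matrix.ProjGenLinGroup.mk g = toPGL (m : PSL2R) := by
    rw [Subgroup.coe_inv, map_inv, inv_mul_eq_one] at hone
    exact hone.symm
  rw [← hg, this]
  exact Subgroup.mem_map_of_mem _ m.2

/-! ### `π̂₁(ℍ/Γ̄)` is slim for `Γ̄` free of rank `≥ 2` -/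

/-- **`π̂₁(ℍ/Γ̄, x₀)` is slim** for `Γ̄ ≤ PSL₂(ℝ)` free of rank `≥ 2` acting freely and properly
discontinuously: `π₁(ℍ/Γ̄, [I]) ≅ Γ̄ᵐᵒᵖ ≅ Γ̄` (Mathlib's `IsQuotientCoveringMap.fundamentalGroupEquiv`, `ℍ`
simply connected) and the profinite completion of a free group of rank `≥ 2` is slim (tree).
[cite: MochizukiAbsTopIII2015, Lemma 4.3 p.106] -/
theorem isSlimGroup_profiniteCompletion_fundamentalGroup_pslQuotient (Γ : Subgroup PSL2R)
    [ProperlyDiscontinuousSMul Γ ℍ] [IsCancelSMul Γ ℍ] [IsFreeGroup Γ]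
    [Finite (IsFreeGroup.Generators Γ)] (h2 : 2 ≤ Nat.card (IsFreeGroup.Generators Γ)) :
    IsSlimGroup (profiniteCompletion
      (FundamentalGroup (pslQuotient Γ).carrier (Quotient.mk (orbitRel Γ ℍ) UpperHalfPlane.I))) := by
  obtain ⟨m, hm, ⟨e⟩⟩ := LocObj.exists_mulEquiv_freeGroup h2 (LocObj.top Γ)
  have eπ : FundamentalGroup (pslQuotient Γ).carrier (Quotient.mk (orbitRel Γ ℍ) UpperHalfPlane.I) ≃*
      Γᵐᵒᵖ :=
    (isQuotientCoveringMap_quotientMk_of_properlyDiscontinuousSMul (G := Γ) (E := ℍ)).fundamentalGroupEquiv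
      ⟨UpperHalfPlane.I, rfl⟩
  exact Literature.GroupTheory.isSlimGroup_profiniteCompletion_of_mulEquiv_freeGroup
    ((eπ.trans (MulEquiv.inv' Γ).symm).trans e) hm

end HolRS

end Literature.AnabelianGeometry.AbsoluteAnabelian

end
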